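import Summits.AnomalousDissipation.AnomalousDissipation.Theorems.ScalarAnomalySteadySourceFormal.Negative.ShearBand

/-!
# Negative knowledge for the crux `ScalarAnomalySteadySourceFormal` (stmt-AnomalousDissipation-0448), VII-d:
# the boundary flux of a box-band under shear–drift stirring

Certified copy of §9.4 of the cdisprove work file.  Two-dimensional geometry of the no-go: the
stirring modes lie on the axis `{k : k 1 = 0, |k 0| ≤ R}` (parallel shear flows in `x₀` directed
along `e₁`, plus a uniform drift `k = 0`), so the transport couples a scalar mode `p` only to
`p ± (n, 0)`: the second index `p 1` (the sector) is conserved.  For the band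
`𝔅 = box K' K₂' \\ box K K₂` the boundary flux of `Negative.ShearBand` therefore lives on two layers,
`K - R < |p 0| ≤ K + R` (inner, sectors `|p 1| ≤ K₂`, weight `|p 1| ≤ K₂` — NOT `K`) and
`K' - R < |p 0| ≤ K' + R` (outer, weight `≤ K₂'`):
`‖bdryFlux‖ ≤ 2 · #S · M · (K₂ · innerLayerSum + K₂' · outerLayerSum)` (`norm_bdryFlux_band_le`).
Also: the Cauchy–Schwarz bound for the source pairing (`norm_sourcePairing_le`).

Supports stmt-AnomalousDissipation-0448 (the shear–drift no-go, files `Shear*`).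
-/

set_option linter.dupNamespace false

noncomputable section

open scoped BigOperators Topology ENNReal NNReal InnerProductSpace ContDiff
open Filter Set Function MeasureTheory UnitAddTorus Complex

namespace Summit.AnomalousDissipation.AnomalousDissipation.Theorems.ScalarAnomalySteadySourceFormal.Negative

open Literature.Analysis
open Literature.Analysis.FunctionSpaces Literature.Analysis.FunctionSpaces.Torus
open Literature.Analysis.FluidPDE Literature.Analysis.FluidPDE.Torus

/-- The frequency lattice `ℤ²` (local notation). -/
local notation "ℤ²" => Fin 2 → ℤ

section Boxes

/-- The box of frequencies `|p 0| ≤ a`, `|p 1| ≤ b`. [folklore] -/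
def box (a b : ℤ) : Finset ℤ² :=
  Fintype.piFinset ![Finset.Icc (-a) a, Finset.Icc (-b) b]

/-- Membership in a box. [folklore] -/
theorem mem_box {a b : ℤ} {p : ℤ²} : p ∈ box a b ↔ |p 0| ≤ a ∧ |p 1| ≤ b := by
  simp only [box, Fintype.mem_piFinset, Fin.forall_fin_two, Matrix.cons_val_zero, Matrix.cons_val_one,
    Finset.mem_Icc, abs_le]

/-- The layer `lo < |p 0| ≤ hi`, `|p 1| ≤ b`. [folklore] -/
def layer (lo hi b : ℤ) : Finset ℤ² :=
  (box hi b).filter fun p => lo < |p 0|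

/-- Membership in a layer. [folklore] -/
theorem mem_layer {lo hi b : ℤ} {p : ℤ²} : p ∈ layer lo hi b ↔ (lo < |p 0| ∧ |p 0| ≤ hi) ∧ |p 1| ≤ b := by
  simp only [layer, Finset.mem_filter, mem_box]
  tauto

/-- The sum of `‖Y p‖²` over a layer. [folklore] -/
def layerSum (lo hi b : ℤ) (Y : ℤ² → ℂ) : ℝ :=
  ∑ p ∈ layer lo hi b, ‖Y p‖ ^ 2

/-- `layerSum ≥ 0`. [folklore] -/
theorem layerSum_nonneg (lo hi b : ℤ) (Y : ℤ² → ℂ) : 0 ≤ layerSum lo hi b Y :=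
  Finset.sum_nonneg fun _ _ => sq_nonneg _

end Boxes

section FluxBound

variable {S : Finset ℤ²} {R : ℕ} {M : ℝ} {cc : ℤ² → EuclideanSpace ℂ (Fin 2)}

/-- On the axis, transversality kills the first component of a non-mean coefficient. [folklore] -/
theorem coeff_zero_eq_zero {k : ℤ²} (hk1 : k 1 = 0) (hk0 : k 0 ≠ 0) (htrans : zdot k (cc k) = 0) :
    cc k 0 = 0 := by
  simp only [zdot, Fin.sum_univ_two, hk1, Int.cast_zero, zero_mul, add_zero, mul_eq_zero, Int.cast_eq_zero] at htrans
  exact htrans.resolve_left hk0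

/-- `‖p · w‖ ≤ |p 1| ‖w‖` when `w 0 = 0`. [folklore] -/
theorem norm_zdot_le {w : EuclideanSpace ℂ (Fin 2)} (hw : w 0 = 0) (p : ℤ²) :
    ‖zdot p w‖ ≤ |(p 1 : ℝ)| * ‖w‖ := by
  simp only [zdot, Fin.sum_univ_two, hw, mul_zero, zero_add, norm_mul, Complex.norm_intCast]
  exact mul_le_mul_of_nonneg_left (PiLp.norm_apply_le w 1) (abs_nonneg _)

/-- **Core layer estimate.**  For a shift `m = (m₀, 0)` with `0 < |m₀| ≤ R` and a vector `w` with
`w 0 = 0`, `‖w‖ ≤ M`, the one-sided boundary interactions of the band `box K' K₂' \\ box K K₂` are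
bounded by `M (K₂ · innerLayerSum + K₂' · outerLayerSum)`. [folklore] -/
theorem sum_boundary_le {K K₂ K' K₂' : ℤ} (hK₂ : 0 ≤ K₂) (hK₂' : 0 ≤ K₂') {m : ℤ²} (hm1 : m 1 = 0)
    (hmR : |m 0| ≤ R) {w : EuclideanSpace ℂ (Fin 2)} (hw : w 0 = 0) (hwM : ‖w‖ ≤ M) (hM : 0 ≤ M) (Y : ℤ² → ℂ) :
    ∑ p ∈ box K' K₂' \ box K K₂,
        (if p - m ∈ box K' K₂' \ box K K₂ then 0 else ‖zdot p w * Y (p - m) * (starRingEnd ℂ) (Y p)‖) ≤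
      M * (K₂ * layerSum (K - R) (K + R) K₂ Y + K₂' * layerSum (K' - R) (K' + R) K₂' Y) := by
  set 𝔅 := box K' K₂' \ box K K₂ with h𝔅
  -- pointwise bound by the two cases
  have hpt : ∀ p ∈ 𝔅, (if p - m ∈ 𝔅 then 0 else ‖zdot p w * Y (p - m) * (starRingEnd ℂ) (Y p)‖) ≤
      (if p - m ∈ box K K₂ then M * K₂ * ((‖Y (p - m)‖ ^ 2 + ‖Y p‖ ^ 2) / 2) else 0) +
      (if p - m ∉ box K' K₂' then M * K₂' * ((‖Y (p - m)‖ ^ 2 + ‖Y p‖ ^ 2) / 2) else 0) := by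
    intro p hp
    have hp' := hp
    simp only [h𝔅, Finset.mem_sdiff, mem_box] at hp'
    have hprod : ‖zdot p w * Y (p - m) * (starRingEnd ℂ) (Y p)‖ ≤ |(p 1 : ℝ)| * M * ((‖Y (p - m)‖ ^ 2 + ‖Y p‖ ^ 2) / 2) := by
      rw [norm_mul, norm_mul, Complex.norm_conj]
      have h2 : ‖Y (p - m)‖ * ‖Y p‖ ≤ (‖Y (p - m)‖ ^ 2 + ‖Y p‖ ^ 2) / 2 := by
        nlinarith [sq_nonneg (‖Y (p - m)‖ - ‖Y p‖), norm_nonneg (Y (p - m)), norm_nonneg (Y p)]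
      calc ‖zdot p w‖ * ‖Y (p - m)‖ * ‖Y p‖ = ‖zdot p w‖ * (‖Y (p - m)‖ * ‖Y p‖) := by ring
        _ ≤ (|(p 1 : ℝ)| * M) * ((‖Y (p - m)‖ ^ 2 + ‖Y p‖ ^ 2) / 2) := by
            refine mul_le_mul ((norm_zdot_le hw p).trans (by gcongr)) h2 (by positivity) (by positivity)
        _ = |(p 1 : ℝ)| * M * ((‖Y (p - m)‖ ^ 2 + ‖Y p‖ ^ 2) / 2) := by ring
    have hp1' : |(p 1 : ℝ)| ≤ K₂' := by
      have : |p 1| ≤ K₂' := hp'.1.2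
      exact_mod_cast this
    have h0 : 0 ≤ (‖Y (p - m)‖ ^ 2 + ‖Y p‖ ^ 2) / 2 := by positivity
    by_cases hq : p - m ∈ 𝔅
    · rw [if_pos hq]
      exact add_nonneg (by split_ifs <;> positivity) (by split_ifs <;> positivity)
    rw [if_neg hq]
    by_cases hA : p - m ∈ box K K₂
    · rw [if_pos hA]
      have hp1 : |(p 1 : ℝ)| ≤ K₂ := by
        have := (mem_box.1 hA).2
        simp only [Pi.sub_apply, hm1, sub_zero] at this
        exact_mod_cast this
      refine le_add_of_le_of_nonneg (hprod.trans ?_) (by split_ifs <;> positivity)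
      calc |(p 1 : ℝ)| * M * ((‖Y (p - m)‖ ^ 2 + ‖Y p‖ ^ 2) / 2) ≤ K₂ * M * ((‖Y (p - m)‖ ^ 2 + ‖Y p‖ ^ 2) / 2) := by
            gcongr
        _ = M * K₂ * ((‖Y (p - m)‖ ^ 2 + ‖Y p‖ ^ 2) / 2) := by ring
    · have hB : p - m ∉ box K' K₂' := fun h' => hq (Finset.mem_sdiff.2 ⟨h', hA⟩)
      rw [if_neg hA, if_pos hB, zero_add]
      refine hprod.trans ?_
      calc |(p 1 : ℝ)| * M * ((‖Y (p - m)‖ ^ 2 + ‖Y p‖ ^ 2) / 2) ≤ K₂' * M * ((‖Y (p - m)‖ ^ 2 + ‖Y p‖ ^ 2) / 2) := by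
            gcongr
        _ = M * K₂' * ((‖Y (p - m)‖ ^ 2 + ‖Y p‖ ^ 2) / 2) := by ring
  refine (Finset.sum_le_sum hpt).trans ?_
  rw [Finset.sum_add_distrib]
  -- the inner layer part
  have hinner : ∑ p ∈ 𝔅, (if p - m ∈ box K K₂ then M * K₂ * ((‖Y (p - m)‖ ^ 2 + ‖Y p‖ ^ 2) / 2) else 0) ≤
      M * (K₂ * layerSum (K - R) (K + R) K₂ Y) := by
    rw [← Finset.sum_filter]
    set A := 𝔅.filter fun p => p - m ∈ box K K₂ with hA
    have hAsub : A ⊆ layer (K - R) (K + R) K₂ := by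
      intro p hp
      simp only [hA, h𝔅, Finset.mem_filter, Finset.mem_sdiff, mem_box, Pi.sub_apply, hm1, sub_zero] at hp
      rw [mem_layer]
      obtain ⟨⟨⟨_, _⟩, hnot⟩, hq0, hq1⟩ := hp
      refine ⟨⟨?_, ?_⟩, hq1⟩
      · have hp0 : K < |p 0| := by
          by_contra hle
          exact hnot ⟨not_lt.1 hle, hq1⟩
        have : (0 : ℤ) ≤ R := Int.natCast_nonneg R
        omega
      · have := abs_sub_abs_le_abs_sub (p 0) (m 0)
        omega
    have hAimg : A.image (fun p => p - m) ⊆ layer (K - R) (K + R) K₂ := by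
      intro q hq
      simp only [Finset.mem_image] at hq
      obtain ⟨p, hp, rfl⟩ := hq
      simp only [hA, h𝔅, Finset.mem_filter, Finset.mem_sdiff, mem_box, Pi.sub_apply, hm1, sub_zero] at hp
      rw [mem_layer]
      simp only [Pi.sub_apply, hm1, sub_zero]
      obtain ⟨⟨⟨_, _⟩, hnot⟩, hq0, hq1⟩ := hp
      refine ⟨⟨?_, ?_⟩, hq1⟩
      · have hp0 : K < |p 0| := by
          by_contra hle
          exact hnot ⟨not_lt.1 hle, hq1⟩
        have := abs_sub_abs_le_abs_sub (p 0) (m 0)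
        omega
      · have : (0 : ℤ) ≤ R := Int.natCast_nonneg R
        omega
    have hinj : Set.InjOn (fun p : ℤ² => p - m) A := fun p _ q _ hpq => sub_left_injective hpq
    calc ∑ p ∈ A, M * K₂ * ((‖Y (p - m)‖ ^ 2 + ‖Y p‖ ^ 2) / 2)
        = M * K₂ / 2 * (∑ p ∈ A, ‖Y (p - m)‖ ^ 2 + ∑ p ∈ A, ‖Y p‖ ^ 2) := by
          rw [← Finset.sum_add_distrib, Finset.mul_sum]
          exact Finset.sum_congr rfl fun p _ => by ring
      _ ≤ M * K₂ / 2 * (layerSum (K - R) (K + R) K₂ Y + layerSum (K - R) (K + R) K₂ Y) := by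
          gcongr
          · rw [← Finset.sum_image (f := fun q => ‖Y q‖ ^ 2) hinj]
            exact Finset.sum_le_sum_of_subset_of_nonneg hAimg fun _ _ _ => sq_nonneg _
          · exact Finset.sum_le_sum_of_subset_of_nonneg hAsub fun _ _ _ => sq_nonneg _
      _ = M * (K₂ * layerSum (K - R) (K + R) K₂ Y) := by ring
  -- the outer layer part
  have houter : ∑ p ∈ 𝔅, (if p - m ∉ box K' K₂' then M * K₂' * ((‖Y (p - m)‖ ^ 2 + ‖Y p‖ ^ 2) / 2) else 0) ≤
      M * (K₂' * layerSum (K' - R) (K' + R) K₂' Y) := by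
    rw [← Finset.sum_filter]
    set B := 𝔅.filter fun p => p - m ∉ box K' K₂' with hB
    have hBsub : B ⊆ layer (K' - R) (K' + R) K₂' := by
      intro p hp
      simp only [hB, h𝔅, Finset.mem_filter, Finset.mem_sdiff, mem_box, Pi.sub_apply, hm1, sub_zero, not_and_or, not_le] at hp
      rw [mem_layer]
      obtain ⟨⟨⟨hp0, hp1⟩, _⟩, hq⟩ := hp
      refine ⟨⟨?_, ?_⟩, hp1⟩
      · rcases hq with hq | hq
        · have := abs_sub (p 0) (m 0)
          omega
        · omega
      · have : (0 : ℤ) ≤ R := Int.natCast_nonneg R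
        omega
    have hBimg : B.image (fun p => p - m) ⊆ layer (K' - R) (K' + R) K₂' := by
      intro q hq
      simp only [Finset.mem_image] at hq
      obtain ⟨p, hp, rfl⟩ := hq
      simp only [hB, h𝔅, Finset.mem_filter, Finset.mem_sdiff, mem_box, Pi.sub_apply, hm1, sub_zero, not_and_or, not_le] at hp
      rw [mem_layer]
      simp only [Pi.sub_apply, hm1, sub_zero]
      obtain ⟨⟨⟨hp0, hp1⟩, _⟩, hq⟩ := hp
      refine ⟨⟨?_, ?_⟩, hp1⟩
      · rcases hq with hq | hq
        · have : (0 : ℤ) ≤ R := Int.natCast_nonneg R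
          omega
        · omega
      · have h1 := abs_sub (p 0) (m 0)
        omega
    have hinj : Set.InjOn (fun p : ℤ² => p - m) B := fun p _ q _ hpq => sub_left_injective hpq
    calc ∑ p ∈ B, M * K₂' * ((‖Y (p - m)‖ ^ 2 + ‖Y p‖ ^ 2) / 2)
        = M * K₂' / 2 * (∑ p ∈ B, ‖Y (p - m)‖ ^ 2 + ∑ p ∈ B, ‖Y p‖ ^ 2) := by
          rw [← Finset.sum_add_distrib, Finset.mul_sum]
          exact Finset.sum_congr rfl fun p _ => by ring
      _ ≤ M * K₂' / 2 * (layerSum (K' - R) (K' + R) K₂' Y + layerSum (K' - R) (K' + R) K₂' Y) := by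
          gcongr
          · rw [← Finset.sum_image (f := fun q => ‖Y q‖ ^ 2) hinj]
            exact Finset.sum_le_sum_of_subset_of_nonneg hBimg fun _ _ _ => sq_nonneg _
          · exact Finset.sum_le_sum_of_subset_of_nonneg hBsub fun _ _ _ => sq_nonneg _
      _ = M * (K₂' * layerSum (K' - R) (K' + R) K₂' Y) := by ring
  calc _ ≤ M * (K₂ * layerSum (K - R) (K + R) K₂ Y) + M * (K₂' * layerSum (K' - R) (K' + R) K₂' Y) :=
        add_le_add hinner houter
    _ = M * (K₂ * layerSum (K - R) (K + R) K₂ Y + K₂' * layerSum (K' - R) (K' + R) K₂' Y) := by ring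

/-- **Boundary flux bound for the box band** under shear–drift stirring:
`‖bdryFlux‖ ≤ 2 · #S · M · (K₂ · innerLayerSum + K₂' · outerLayerSum)`. [folklore] -/
theorem norm_bdryFlux_band_le {K K₂ K' K₂' : ℤ} (hK₂ : 0 ≤ K₂) (hK₂' : 0 ≤ K₂')
    (hS : ∀ k ∈ S, k 1 = 0 ∧ |k 0| ≤ R) (htrans : ∀ k ∈ S, zdot k (cc k) = 0)
    (hM : ∀ k, ‖cc k‖ ≤ M) (hM0 : 0 ≤ M) (Y : ℤ² → ℂ) :
    ‖bdryFlux S (box K' K₂' \ box K K₂) cc Y‖ ≤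
      2 * S.card * M * (K₂ * layerSum (K - R) (K + R) K₂ Y + K₂' * layerSum (K' - R) (K' + R) K₂' Y) := by
  set 𝔅 := box K' K₂' \ box K K₂ with h𝔅
  set L : ℝ := M * (K₂ * layerSum (K - R) (K + R) K₂ Y + K₂' * layerSum (K' - R) (K' + R) K₂' Y) with hL
  have hL0 : 0 ≤ L := by
    have := layerSum_nonneg (K - R) (K + R) K₂ Y
    have := layerSum_nonneg (K' - R) (K' + R) K₂' Y
    positivity
  -- each `k ∈ S` contributes at most `2L`
  have hk : ∀ k ∈ S, ∑ p ∈ 𝔅, ‖(if p - k ∈ 𝔅 then 0 else zdot p (cc k) * Y (p - k) * (starRingEnd ℂ) (Y p)) +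
      (if p + k ∈ 𝔅 then 0 else zdot p (EuclideanSpace.conjVec (cc k)) * Y (p + k) * (starRingEnd ℂ) (Y p))‖ ≤ 2 * L := by
    intro k hkS
    by_cases hk0 : k 0 = 0
    · have hkz : k = 0 := by
        funext i; fin_cases i
        · exact hk0
        · exact (hS k hkS).1
      subst hkz
      simp only [sub_zero, add_zero]
      calc ∑ p ∈ 𝔅, ‖(if p ∈ 𝔅 then 0 else zdot p (cc 0) * Y p * (starRingEnd ℂ) (Y p)) +
            (if p ∈ 𝔅 then 0 else zdot p (EuclideanSpace.conjVec (cc 0)) * Y p * (starRingEnd ℂ) (Y p))‖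
          = ∑ p ∈ 𝔅, (0 : ℝ) := Finset.sum_congr rfl fun p hp => by rw [if_pos hp, if_pos hp, add_zero, norm_zero]
        _ ≤ 2 * L := by rw [Finset.sum_const_zero]; positivity
    have hw0 : cc k 0 = 0 := coeff_zero_eq_zero (hS k hkS).1 hk0 (htrans k hkS)
    have hplus := sum_boundary_le (R := R) (K := K) (K' := K') hK₂ hK₂' (m := k) (hS k hkS).1 (hS k hkS).2 hw0 (hM k) hM0 Y
    have hminus := sum_boundary_le (R := R) (K := K) (K' := K') hK₂ hK₂' (m := -k) (by simp [(hS k hkS).1])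
      (by simpa using (hS k hkS).2) (w := EuclideanSpace.conjVec (cc k))
      (by simp [EuclideanSpace.conjVec_apply, hw0]) (by rw [EuclideanSpace.norm_conjVec]; exact hM k) hM0 Y
    simp only [sub_neg_eq_add] at hminus
    calc _ ≤ ∑ p ∈ 𝔅, ((if p - k ∈ 𝔅 then 0 else ‖zdot p (cc k) * Y (p - k) * (starRingEnd ℂ) (Y p)‖) +
          (if p + k ∈ 𝔅 then 0 else ‖zdot p (EuclideanSpace.conjVec (cc k)) * Y (p + k) * (starRingEnd ℂ) (Y p)‖)) := by
          refine Finset.sum_le_sum fun p _ => (norm_add_le _ _).trans (add_le_add ?_ ?_) <;>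
            split_ifs <;> simp
      _ ≤ L + L := by rw [Finset.sum_add_distrib]; exact add_le_add hplus hminus
      _ = 2 * L := by ring
  calc ‖bdryFlux S 𝔅 cc Y‖ ≤ ∑ p ∈ 𝔅, ∑ k ∈ S, ‖(if p - k ∈ 𝔅 then 0 else zdot p (cc k) * Y (p - k) * (starRingEnd ℂ) (Y p)) +
        (if p + k ∈ 𝔅 then 0 else zdot p (EuclideanSpace.conjVec (cc k)) * Y (p + k) * (starRingEnd ℂ) (Y p))‖ := by
        unfold bdryFlux
        exact (norm_sum_le _ _).trans (Finset.sum_le_sum fun p _ => norm_sum_le _ _)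
    _ = ∑ k ∈ S, ∑ p ∈ 𝔅, ‖(if p - k ∈ 𝔅 then 0 else zdot p (cc k) * Y (p - k) * (starRingEnd ℂ) (Y p)) +
        (if p + k ∈ 𝔅 then 0 else zdot p (EuclideanSpace.conjVec (cc k)) * Y (p + k) * (starRingEnd ℂ) (Y p))‖ :=
        Finset.sum_comm
    _ ≤ ∑ k ∈ S, 2 * L := Finset.sum_le_sum hk
    _ = 2 * S.card * M * (K₂ * layerSum (K - R) (K + R) K₂ Y + K₂' * layerSum (K' - R) (K' + R) K₂' Y) := by
        rw [Finset.sum_const, nsmul_eq_mul, hL]; ring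

end FluxBound

section SourceBound

variable {d : Type*} [Fintype d]

/-- **Cauchy–Schwarz for the source pairing**:
`‖∑_{p∈𝔅} 𝓕h(p) conj Y_p‖ ≤ (∑_{p∈𝔅} ‖𝓕h(p)‖²)^{1/2} (∑_{p∈𝔅} ‖Y_p‖²)^{1/2}`. [folklore] -/
theorem norm_sourcePairing_le (𝔅 : Finset (d → ℤ)) (h : UnitAddTorus d → ℝ) (Y : (d → ℤ) → ℂ) :
    ‖sourcePairing 𝔅 h Y‖ ≤
      Real.sqrt (∑ p ∈ 𝔅, ‖mFourierCoeff (fun x => (h x : ℂ)) p‖ ^ 2) * Real.sqrt (∑ p ∈ 𝔅, ‖Y p‖ ^ 2) := by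
  unfold sourcePairing
  refine (norm_sum_le _ _).trans ?_
  have e : ∀ p ∈ 𝔅, ‖mFourierCoeff (fun x => (h x : ℂ)) p * (starRingEnd ℂ) (Y p)‖ =
      ‖mFourierCoeff (fun x => (h x : ℂ)) p‖ * ‖Y p‖ := fun p _ => by rw [norm_mul, Complex.norm_conj]
  rw [Finset.sum_congr rfl e]
  have hcs := Finset.sum_mul_sq_le_sq_mul_sq 𝔅 (fun p => ‖mFourierCoeff (fun x => (h x : ℂ)) p‖) (fun p => ‖Y p‖)
  have h0 : 0 ≤ ∑ p ∈ 𝔅, ‖mFourierCoeff (fun x => (h x : ℂ)) p‖ * ‖Y p‖ :=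
    Finset.sum_nonneg fun p _ => mul_nonneg (norm_nonneg _) (norm_nonneg _)
  rw [← Real.sqrt_mul (Finset.sum_nonneg fun _ _ => sq_nonneg _), Real.le_sqrt h0]
  · exact hcs
  · exact mul_nonneg (Finset.sum_nonneg fun _ _ => sq_nonneg _) (Finset.sum_nonneg fun _ _ => sq_nonneg _)

end SourceBound

end Summit.AnomalousDissipation.AnomalousDissipation.Theorems.ScalarAnomalySteadySourceFormal.Negative
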